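import Mathlib.Analysis.Calculus.Taylor
import Mathlib.Analysis.Analytic.Basic
import Mathlib.Analysis.Analytic.ConvergenceRadius
import Mathlib.Analysis.SpecificLimits.Normed
import HarnessLib

/-!
# Real-analyticity from factorial bounds on the derivatives

A smooth function `g : ℝ → E` (with values in a complete real normed space) whose iterated
derivatives satisfy `‖g⁽ᵏ⁾(t)‖ ≤ M C^k k!` for all `k` and `t` is real analytic at every point:
its Taylor series at `t₀` has radius of convergence at least `(C + 1)⁻¹ / 2` and, by Taylor's
formula with the integral remainder (Mathlib's `taylor_integral_remainder`), the remainder after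
`N + 1` terms is at most `M (N + 1) (C' |y|)^{N+1} → 0`, `C' = |C| + 1`. This is the classical
sufficiency half of the characterisation of real-analytic functions by derivative bounds
(Krantz–Parks, *A Primer of Real Analytic Functions*, Prop. 1.2.10-type statement); it is the
calculus step in the analyticity of `K`-finite `Z(𝔤)`-finite vectors along one-parameter subgroups
(Harish-Chandra 1953, Lemma 34, weak form; `Literature/NumberTheory/Automorphic`).

* `taylorCoeffSeries g t₀` — the formal power series `∑ (k!)⁻¹ g⁽ᵏ⁾(t₀) yᵏ`;
* `hasFPowerSeriesOnBall_of_norm_iteratedDeriv_le` — it sums to `g` on a ball;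
* `analyticAt_of_norm_iteratedDeriv_le` — hence `g` is analytic at `t₀`.

Everything here is proved; no named facts.

## References

* S. G. Krantz, H. R. Parks, *A Primer of Real Analytic Functions*, 2nd ed. (2002), §1.2.
* Harish-Chandra, *Representations of a semisimple Lie group on a Banach space. I*, Trans. AMS 75
  (1953), §7 and Lemma 34 [HarishChandraTAMS1953].
-/

open Set Filter intervalIntegral
open scoped Topology ContDiff NNReal ENNReal Nat

noncomputable section

namespace Literature.Analysis.Calculus

variable {E : Type*} [NormedAddCommGroup E] [NormedSpace ℝ E]

/-- The Taylor coefficient series of `g` at `t₀`: the `k`-th term is the `k`-linear map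
`(y₁, …, y_k) ↦ (y₁ ⋯ y_k) • (k!)⁻¹ g⁽ᵏ⁾(t₀)` (`ContinuousMultilinearMap.mkPiRing`). [folklore] -/
def taylorCoeffSeries (g : ℝ → E) (t₀ : ℝ) : FormalMultilinearSeries ℝ ℝ E := fun k ↦
  ContinuousMultilinearMap.mkPiRing ℝ (Fin k) (((k ! : ℝ))⁻¹ • iteratedDeriv k g t₀)

/-- On the diagonal the `k`-th Taylor term is `yᵏ • (k!)⁻¹ g⁽ᵏ⁾(t₀)`. [folklore] -/
theorem taylorCoeffSeries_apply (g : ℝ → E) (t₀ : ℝ) (k : ℕ) (y : ℝ) :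
    taylorCoeffSeries g t₀ k (fun _ ↦ y) = y ^ k • (((k ! : ℝ))⁻¹ • iteratedDeriv k g t₀) := by
  simp [taylorCoeffSeries, ContinuousMultilinearMap.mkPiRing_apply, Finset.prod_const]

/-- The norm of the `k`-th Taylor term is `‖(k!)⁻¹ g⁽ᵏ⁾(t₀)‖`. [folklore] -/
theorem norm_taylorCoeffSeries (g : ℝ → E) (t₀ : ℝ) (k : ℕ) :
    ‖taylorCoeffSeries g t₀ k‖ = ‖((k ! : ℝ))⁻¹ • iteratedDeriv k g t₀‖ := by
  simp only [taylorCoeffSeries, ContinuousMultilinearMap.norm_mkPiRing]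

/-- Under `‖g⁽ᵏ⁾(t)‖ ≤ M Cᵏ k!`, the Taylor coefficients satisfy `‖(k!)⁻¹ g⁽ᵏ⁾(t₀)‖ ≤ M |C|ᵏ`.
[folklore] -/
theorem norm_taylorCoeff_le {g : ℝ → E} {M C : ℝ}
    (hb : ∀ k t, ‖iteratedDeriv k g t‖ ≤ M * C ^ k * k !) (t₀ : ℝ) (k : ℕ) :
    ‖((k ! : ℝ))⁻¹ • iteratedDeriv k g t₀‖ ≤ M * |C| ^ k := by
  have hM : 0 ≤ M := by simpa using (norm_nonneg _).trans (hb 0 t₀)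
  have hk : (0 : ℝ) < k ! := by positivity
  rw [norm_smul, norm_inv, Real.norm_natCast, inv_mul_le_iff₀ hk]
  calc ‖iteratedDeriv k g t₀‖ ≤ M * C ^ k * k ! := hb k t₀
    _ ≤ M * |C| ^ k * k ! :=
        mul_le_mul_of_nonneg_right
          (mul_le_mul_of_nonneg_left ((le_abs_self _).trans_eq (abs_pow C k)) hM)
          (by positivity)
    _ = k ! * (M * |C| ^ k) := by ring

/-- The radius of convergence of the Taylor series is at least `r` whenever `(|C| + 1) r ≤ 1`.
[folklore] -/
theorem le_radius_taylorCoeffSeries {g : ℝ → E} {M C : ℝ}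
    (hb : ∀ k t, ‖iteratedDeriv k g t‖ ≤ M * C ^ k * k !) (t₀ : ℝ) {r : ℝ≥0}
    (hr : (|C| + 1) * r ≤ 1) : (r : ℝ≥0∞) ≤ (taylorCoeffSeries g t₀).radius := by
  have hM : 0 ≤ M := by simpa using (norm_nonneg _).trans (hb 0 t₀)
  refine (taylorCoeffSeries g t₀).le_radius_of_bound M fun k ↦ ?_
  rw [norm_taylorCoeffSeries]
  have h1 : |C| * (r : ℝ) ≤ 1 := by nlinarith [abs_nonneg C, r.2]
  calc ‖((k ! : ℝ))⁻¹ • iteratedDeriv k g t₀‖ * (r : ℝ) ^ k ≤ M * |C| ^ k * (r : ℝ) ^ k :=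
        mul_le_mul_of_nonneg_right (norm_taylorCoeff_le hb t₀ k) (by positivity)
    _ = M * (|C| * r) ^ k := by rw [mul_pow]; ring
    _ ≤ M * 1 := mul_le_mul_of_nonneg_left (pow_le_one₀ (by positivity) h1) hM
    _ = M := mul_one M

/-- **Taylor's remainder bound.** For smooth `g` with `‖g⁽ᵏ⁾(t)‖ ≤ M Cᵏ k!` everywhere and `y ≠ 0`,
`‖g(t₀ + y) - ∑_{k ≤ N} yᵏ (k!)⁻¹ g⁽ᵏ⁾(t₀)‖ ≤ M (N + 1) (|C| |y|)^{N+1}`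
(integral form of the remainder, `taylor_integral_remainder`). [folklore] -/
theorem norm_sub_taylor_sum_le [CompleteSpace E] {g : ℝ → E} (hg : ContDiff ℝ ∞ g) {M C : ℝ}
    (hb : ∀ k t, ‖iteratedDeriv k g t‖ ≤ M * C ^ k * k !) (t₀ : ℝ) {y : ℝ} (hy : y ≠ 0) (N : ℕ) :
    ‖g (t₀ + y) - ∑ k ∈ Finset.range (N + 1), y ^ k • (((k ! : ℝ))⁻¹ • iteratedDeriv k g t₀)‖ ≤
      M * (N + 1) * (|C| * |y|) ^ (N + 1) := by
  have hM : 0 ≤ M := by simpa using (norm_nonneg _).trans (hb 0 t₀)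
  set x := t₀ + y with hx
  have hne : t₀ ≠ x := by simp [hx, hy]
  have hU : UniqueDiffOn ℝ (uIcc t₀ x) := uniqueDiffOn_Icc (inf_lt_sup.mpr hne)
  have hgN : ContDiff ℝ (N + 1 : ℕ) g := hg.of_le (mod_cast le_top)
  -- identify Mathlib's Taylor polynomial within `uIcc t₀ x` with the unrestricted one
  have hwithin : ∀ k ≤ N + 1, ∀ t ∈ uIcc t₀ x, iteratedDerivWithin k g (uIcc t₀ x) t =
      iteratedDeriv k g t := fun k hk t ht ↦
    iteratedDerivWithin_eq_iteratedDeriv hU ((hg.of_le (mod_cast le_top)).contDiffAt) ht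
  have hpoly : taylorWithinEval g N (uIcc t₀ x) t₀ x =
      ∑ k ∈ Finset.range (N + 1), y ^ k • (((k ! : ℝ))⁻¹ • iteratedDeriv k g t₀) := by
    rw [taylor_within_apply]
    refine Finset.sum_congr rfl fun k hk ↦ ?_
    rw [hwithin k (by simp at hk; omega) t₀ left_mem_uIcc, smul_smul]
    congr 1
    rw [hx, add_sub_cancel_left, mul_comm]
  rw [← hpoly, taylor_integral_remainder hgN.contDiffOn]
  -- bound the integral remainder
  have hbound : ∀ t ∈ Set.uIoc t₀ x,
      ‖((x - t) ^ N / N !) • iteratedDerivWithin (N + 1) g (uIcc t₀ x) t‖ ≤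
        |y| ^ N / N ! * (M * |C| ^ (N + 1) * (N + 1)!) := by
    intro t ht
    have ht' : t ∈ uIcc t₀ x := uIoc_subset_uIcc ht
    rw [hwithin (N + 1) le_rfl t ht', norm_smul, norm_div, Real.norm_natCast, norm_pow,
      Real.norm_eq_abs]
    refine mul_le_mul ?_ ?_ (norm_nonneg _) (by positivity)
    · have habs : |x - t| ≤ |y| := by
        rcases mem_uIoc.mp ht with ⟨h1, h2⟩ | ⟨h1, h2⟩
        · have hy0 : 0 < y := by linarith
          rw [abs_of_pos hy0, abs_le]
          constructor <;> linarith
        · have hy0 : y < 0 := by linarith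
          rw [abs_of_neg hy0, abs_le]
          constructor <;> linarith
      exact div_le_div_of_nonneg_right (pow_le_pow_left₀ (abs_nonneg _) habs N) (by positivity)
    · calc ‖iteratedDeriv (N + 1) g t‖ ≤ M * C ^ (N + 1) * (N + 1)! := hb _ _
        _ ≤ M * |C| ^ (N + 1) * (N + 1)! :=
            mul_le_mul_of_nonneg_right
              (mul_le_mul_of_nonneg_left ((le_abs_self _).trans_eq (abs_pow C _)) hM)
              (by positivity)
  refine (norm_integral_le_of_norm_le_const hbound).trans (le_of_eq ?_)
  rw [hx, add_sub_cancel_left, Nat.factorial_succ, Nat.cast_mul, Nat.cast_add, Nat.cast_one]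
  field_simp
  ring

/-- **The Taylor series converges to `g` on a ball** (`HasFPowerSeriesOnBall`): for smooth
`g : ℝ → E` (`E` complete) with `‖g⁽ᵏ⁾(t)‖ ≤ M Cᵏ k!` for all `k, t`, the Taylor series of `g` at
`t₀` sums to `g` on the ball of radius `((|C| + 1) 2)⁻¹`. Krantz–Parks, §1.2; Harish-Chandra
1953, §7. [folklore] -/
theorem hasFPowerSeriesOnBall_of_norm_iteratedDeriv_le [CompleteSpace E] {g : ℝ → E}
    (hg : ContDiff ℝ ∞ g) {M C : ℝ} (hb : ∀ k t, ‖iteratedDeriv k g t‖ ≤ M * C ^ k * k !)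
    (t₀ : ℝ) :
    HasFPowerSeriesOnBall g (taylorCoeffSeries g t₀) t₀ (ENNReal.ofReal ((|C| + 1) * 2)⁻¹) := by
  have hM : 0 ≤ M := by simpa using (norm_nonneg _).trans (hb 0 t₀)
  have hC1 : 0 < |C| + 1 := by positivity
  set ρ : ℝ := ((|C| + 1) * 2)⁻¹ with hρ
  have hρ0 : 0 < ρ := by positivity
  have hrC : (|C| + 1) * ((ρ.toNNReal : ℝ≥0) : ℝ) ≤ 1 := by
    rw [Real.coe_toNNReal ρ hρ0.le, hρ]
    field_simp
    norm_num
  refine ⟨le_radius_taylorCoeffSeries hb t₀ hrC, ENNReal.ofReal_pos.mpr hρ0, fun {y} hy ↦ ?_⟩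
  -- `|y| < ρ`, so `q = |C| |y| < 1/2`
  have hy' : |y| < ρ := by
    rw [Metric.eball_ofReal, Metric.mem_ball, dist_zero_right, Real.norm_eq_abs] at hy
    exact hy
  have hq1 : |C| * |y| < 1 := by
    have h2 : (|C| + 1) * |y| < 1 := by
      calc (|C| + 1) * |y| < (|C| + 1) * ρ := mul_lt_mul_of_pos_left hy' hC1
        _ = 2⁻¹ := by rw [hρ]; field_simp
        _ ≤ 1 := by norm_num
    nlinarith [abs_nonneg C, abs_nonneg y]
  have hq0 : 0 ≤ |C| * |y| := by positivity
  simp only [taylorCoeffSeries_apply]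
  rcases eq_or_ne y 0 with rfl | hy0
  · -- at `y = 0` only the constant term survives
    simpa using (hasSum_single (f := fun k : ℕ ↦ (0 : ℝ) ^ k • (((k ! : ℝ))⁻¹ •
      iteratedDeriv k g t₀)) 0 (fun k hk ↦ by simp [zero_pow hk]))
  -- the series is absolutely convergent (geometric domination), hence has a sum `S`
  set f : ℕ → E := fun k ↦ y ^ k • (((k ! : ℝ))⁻¹ • iteratedDeriv k g t₀) with hf
  have hfs : Summable f := by
    refine Summable.of_norm_bounded (g := fun k ↦ M * (|C| * |y|) ^ k)
      ((summable_geometric_of_lt_one hq0 hq1).mul_left M) fun k ↦ ?_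
    rw [hf, norm_smul, norm_pow, Real.norm_eq_abs, mul_pow]
    calc |y| ^ k * ‖((k ! : ℝ))⁻¹ • iteratedDeriv k g t₀‖ ≤ |y| ^ k * (M * |C| ^ k) :=
          mul_le_mul_of_nonneg_left (norm_taylorCoeff_le hb t₀ k) (by positivity)
      _ = M * (|C| ^ k * |y| ^ k) := by ring
  -- its partial sums tend to `g (t₀ + y)` by the remainder bound
  have hlim : Tendsto (fun N ↦ ∑ k ∈ Finset.range N, f k) atTop (𝓝 (g (t₀ + y))) := by
    rw [← tendsto_add_atTop_iff_nat 1]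
    refine tendsto_iff_norm_sub_tendsto_zero.mpr ?_
    have hmaj : ∀ N, ‖∑ k ∈ Finset.range (N + 1), f k - g (t₀ + y)‖ ≤
        M * (N + 1) * (|C| * |y|) ^ (N + 1) := fun N ↦ by
      rw [norm_sub_rev]; exact norm_sub_taylor_sum_le hg hb t₀ hy0 N
    have hzero : Tendsto (fun N : ℕ ↦ M * (N + 1) * (|C| * |y|) ^ (N + 1)) atTop (𝓝 0) := by
      have h := (tendsto_self_mul_const_pow_of_lt_one hq0 hq1).comp (tendsto_add_atTop_nat 1)
      have h' := h.const_mul M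
      rw [mul_zero] at h'
      refine h'.congr fun N ↦ ?_
      simp [Function.comp, mul_assoc]
    exact squeeze_zero (fun N ↦ norm_nonneg _) hmaj hzero
  -- so the sum is `g (t₀ + y)`
  have huniq : ∑' k, f k = g (t₀ + y) :=
    tendsto_nhds_unique hfs.hasSum.tendsto_sum_nat hlim
  exact huniq ▸ hfs.hasSum

/-- **Analyticity from factorial derivative bounds.** A smooth `g : ℝ → E` (`E` a complete real
normed space) with `‖g⁽ᵏ⁾(t)‖ ≤ M Cᵏ k!` for all `k` and `t` is real analytic at every point.
Krantz–Parks, §1.2 (characterisation of real-analytic functions); Harish-Chandra 1953, §7.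
[folklore] -/
theorem analyticAt_of_norm_iteratedDeriv_le [CompleteSpace E] {g : ℝ → E} (hg : ContDiff ℝ ∞ g)
    {M C : ℝ} (hb : ∀ k t, ‖iteratedDeriv k g t‖ ≤ M * C ^ k * k !) (t₀ : ℝ) :
    AnalyticAt ℝ g t₀ :=
  ⟨_, _, hasFPowerSeriesOnBall_of_norm_iteratedDeriv_le hg hb t₀⟩

/-- The smoothness hypothesis in the form it arises in practice: if every iterated derivative of
`g` is differentiable, `g` is `C^∞` (`contDiff_of_differentiable_iteratedDeriv`). [folklore] -/
theorem contDiff_infty_of_differentiable_iteratedDeriv {g : ℝ → E}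
    (hd : ∀ k, Differentiable ℝ (iteratedDeriv k g)) : ContDiff ℝ ∞ g :=
  contDiff_of_differentiable_iteratedDeriv fun k _ ↦ hd k

end Literature.Analysis.Calculus
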